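import Mathlib
import Literature.Combinatorics.StablePolynomials.Basic
import Literature.Combinatorics.StablePolynomials.Limits
import HarnessLib

/-!
# Restrictions of real stable polynomials to coordinate lines are real-rooted

Topic `Literature/Combinatorics/StablePolynomials`; companion of `Basic.lean` (which defines
`IsUpperHalfPlaneStable p :↔ ∀ z, (∀ i, 0 < Im (z i)) → p(z) ≠ 0` and
`IsRealStable q :↔ IsUpperHalfPlaneStable (map (algebraMap ℝ ℂ) q)`) and of `Limits.lean`
(multivariate Hurwitz; `IsUpperHalfPlaneStable.specialize_real`).

For a real stable `q ∈ ℝ[z_σ]` (`σ` finite), a real point `x ∈ ℝ^σ` and a coordinate `i`, the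
univariate restriction `R(t) = q(x with xᵢ := t)` — realised as the `Polynomial ℝ`
`MvPolynomial.aeval (fun j => if j = i then X else C (x j)) q` — is either `0` or has only real
complex roots (Borcea–Brändén, Invent. Math. 177 (2009), Lemma 1.7 (1): for `f` stable and
`a ∈ ℝ`, `f(a, z₂, …, zₙ)` is stable or identically zero, iterated over all coordinates `j ≠ i`,
combined with the one-variable fact (loc. cit., §1) that a real univariate polynomial is stable
iff it is real-rooted; Wagner, Bull. AMS 48 (2011), Lemma 2.4 (d)).

## Main results (namespace `Literature.Combinatorics.StablePolynomials`)

* `IsUpperHalfPlaneStable.bind₁_ite_real_eq_zero_or` — freezing all variables but `zᵢ` of a stable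
  polynomial at real values gives `0` or a stable polynomial (proved in one step from the
  continuous-family Hurwitz lemma `eq_zero_or_isUpperHalfPlaneStable_of_mem_closure` of
  `Limits.lean`: the frozen values `a ∈ H^σ` give stable polynomials, and `ℝ^σ ⊆ closure H^σ`).
* `eval_map_aeval_ite` — the complexified univariate restriction evaluated at `t` is `q` evaluated
  through `ℝ → ℂ` at the point `(x with xᵢ := t)`.
* `conj_eval_map_algebraMap` — complex conjugation commutes with evaluation of a real univariate
  polynomial.
* `IsRealStable.aeval_line_eq_zero_or_im_eq_zero` — **the restriction of a real stable polynomial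
  to a coordinate line through a real point is `0` or real-rooted**.

## Mathlib / tree search

REUSED (tree): `eval_bind₁`, `eq_zero_or_isUpperHalfPlaneStable_of_mem_closure`,
`isRealStable_iff`-style unfolding; (Mathlib) `closure_pi_set`, `Complex.closure_setOf_lt_im`,
`MvPolynomial.continuous_eval`, `Polynomial.funext`, `Polynomial.map_eq_zero_iff`,
`Polynomial.hom_eval₂`. Mathlib has no notion of stable polynomial (see `Basic.lean`).

## References

* J. Borcea, P. Brändén, *The Lee–Yang and Pólya–Schur programs. I. Linear operators preserving
  stability*, Invent. Math. 177 (2009) 541–569, §1, Lemma 1.7 (1). [BorceaBranden2009]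
* D. G. Wagner, *Multivariate stable polynomials: theory and applications*, Bull. Amer. Math.
  Soc. 48 (2011) 53–84, §2, Lemma 2.4 (d). [Wagner2011]
* P. Brändén, *Polynomials with the half-plane property and matroid theory*, Adv. Math. 216
  (2007), §3 (real stable univariate = real-rooted). [Branden2007]
-/

noncomputable section

open MvPolynomial
open scoped ComplexConjugate

namespace Literature.Combinatorics.StablePolynomials

variable {σ : Type*}

/-- Evaluating the polynomial obtained by freezing every variable but `zᵢ` at the values `a j`:
`(p|_{z_j := a_j (j ≠ i)})(z) = p(a with aᵢ := zᵢ)`. [folklore] -/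
theorem eval_bind₁_ite [DecidableEq σ] (p : MvPolynomial σ ℂ) (i : σ) (a z : σ → ℂ) :
    eval z (bind₁ (fun j => if j = i then X i else C (a j)) p) =
      eval (fun j => if j = i then z i else a j) p := by
  rw [eval_bind₁]
  have h : (fun j => eval z (if j = i then X i else C (a j))) = fun j => if j = i then z i else a j := by
    funext j
    split_ifs with hj
    · rw [eval_X]
    · rw [eval_C]
  rw [h]

/-- **Freezing all variables but one at real values gives `0` or a stable polynomial**
(Borcea–Brändén 2009, Lemma 1.7 (1), "for `a ∈ ℝ`, `f(a, z₂, …, zₙ) ∈ 𝓗_{n-1} ∪ {0}`", applied to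
every coordinate `j ≠ i`; Wagner 2011, Lemma 2.4 (d)). Proof: for frozen values `a ∈ H^σ` the
polynomial `p(a with aᵢ := zᵢ)` is stable outright, the family is jointly continuous in `(a, z)`,
and the real point `x` lies in the closure of `H^σ`; conclude by the continuous-family form of the
multivariate Hurwitz theorem (`eq_zero_or_isUpperHalfPlaneStable_of_mem_closure`).
[cite: BorceaBranden2009, §1, Lemma 1.7 (1)] -/
theorem IsUpperHalfPlaneStable.bind₁_ite_real_eq_zero_or [Finite σ] [DecidableEq σ]
    {p : MvPolynomial σ ℂ} (hp : IsUpperHalfPlaneStable p) (x : σ → ℝ) (i : σ) :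
    bind₁ (fun j => if j = i then X i else C (x j : ℂ)) p = 0 ∨
      IsUpperHalfPlaneStable (bind₁ (fun j => if j = i then X i else C (x j : ℂ)) p) := by
  let P : (σ → ℂ) → MvPolynomial σ ℂ := fun a => bind₁ (fun j => if j = i then X i else C (a j)) p
  have hF : Continuous fun az : (σ → ℂ) × (σ → ℂ) => fun j => if j = i then az.2 i else az.1 j :=
    continuous_pi fun j =>
      Continuous.if_const _ ((continuous_apply i).comp continuous_snd)
        ((continuous_apply j).comp continuous_fst)
  have hP : Continuous fun az : (σ → ℂ) × (σ → ℂ) => eval az.2 (P az.1) := by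
    simp only [P, eval_bind₁_ite]
    exact (MvPolynomial.continuous_eval (p := p)).comp hF
  have hs : ∀ a ∈ {a : σ → ℂ | ∀ j, 0 < (a j).im}, IsUpperHalfPlaneStable (P a) := by
    intro a ha z hz
    have ha' : ∀ j, 0 < (a j).im := ha
    simp only [P, eval_bind₁_ite]
    refine hp _ fun j => ?_
    split_ifs
    · exact hz i
    · exact ha' j
  have hq : (fun j => ((x j : ℝ) : ℂ)) ∈ closure {a : σ → ℂ | ∀ j, 0 < (a j).im} := by
    have hset : {a : σ → ℂ | ∀ j, 0 < (a j).im} = Set.pi Set.univ (fun _ => {w : ℂ | 0 < w.im}) := by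
      ext a; simp
    rw [hset, closure_pi_set]
    refine Set.mem_univ_pi.2 fun j => ?_
    rw [Complex.closure_setOf_lt_im]
    simp
  exact eq_zero_or_isUpperHalfPlaneStable_of_mem_closure hP hs hq

/-- **The univariate restriction, evaluated**: for `q ∈ ℝ[z_σ]`, the complexification of the
`Polynomial ℝ` `q(x with xᵢ := X)` evaluated at `t ∈ ℂ` is `q` evaluated through `ℝ → ℂ` at the
point `(x with xᵢ := t)`. Both sides are ring homomorphisms in `q`; checked on `C a` and `X j`.
[folklore] -/
theorem eval_map_aeval_ite [DecidableEq σ] (q : MvPolynomial σ ℝ) (x : σ → ℝ) (i : σ) (t : ℂ) :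
    ((aeval (fun j => if j = i then (Polynomial.X : Polynomial ℝ) else Polynomial.C (x j)) q).map
        (algebraMap ℝ ℂ)).eval t =
      eval (fun j => if j = i then t else (x j : ℂ)) (map (algebraMap ℝ ℂ) q) := by
  induction q using MvPolynomial.induction_on with
  | C a => simp
  | add p q hp hq =>
    simp only [map_add, Polynomial.map_add, Polynomial.eval_add, hp, hq]
  | mul_X p j hp =>
    simp only [map_mul, Polynomial.map_mul, Polynomial.eval_mul, hp, aeval_X, map_X, eval_X]
    by_cases h : j = i
    · subst h
      simp
    · simp [h]

/-- For a real univariate polynomial, conjugating the point conjugates the value. [folklore] -/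
theorem conj_eval_map_algebraMap (R : Polynomial ℝ) (t : ℂ) :
    conj ((R.map (algebraMap ℝ ℂ)).eval t) = (R.map (algebraMap ℝ ℂ)).eval (conj t) := by
  rw [Polynomial.eval_map, Polynomial.eval_map, Polynomial.hom_eval₂]
  congr 1
  exact RingHom.ext fun r => Complex.conj_ofReal r

/-- **Restrictions of real stable polynomials to coordinate lines are real-rooted**
(Borcea–Brändén 2009, Lemma 1.7 (1) with §1, "a univariate polynomial with real coefficients is
stable iff all its zeros are real"; Wagner 2011, Lemma 2.4 (d)): for a real stable
`q ∈ ℝ[z_σ]` (`σ` finite), a real point `x` and a coordinate `i`, the univariate restriction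
`R(t) = q(x with xᵢ := t)`, realised as `aeval (fun j => if j = i then X else C (x j)) q`, is `0`
or every complex root of (the complexification of) `R` is real. Proof: freeze the coordinates
`j ≠ i` at `x j` in the stable complexification (`bind₁_ite_real_eq_zero_or`: result `Q` is `0` or
stable); `Q(z) = R_ℂ(zᵢ)`; if `Q = 0` then `R_ℂ` vanishes identically, so `R = 0`; otherwise a
root `t` with `Im t > 0` gives the zero `(t, …, t) ∈ H^σ` of `Q`, and one with `Im t < 0` gives the
zero `(t̄, …, t̄)` (real coefficients). [cite: BorceaBranden2009, §1, Lemma 1.7 (1)] -/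
theorem IsRealStable.aeval_line_eq_zero_or_im_eq_zero [Finite σ] [DecidableEq σ]
    {q : MvPolynomial σ ℝ} (hq : IsRealStable q) (x : σ → ℝ) (i : σ) :
    aeval (fun j => if j = i then (Polynomial.X : Polynomial ℝ) else Polynomial.C (x j)) q = 0 ∨
      ∀ t : ℂ, ((aeval (fun j => if j = i then (Polynomial.X : Polynomial ℝ) else
        Polynomial.C (x j)) q).map (algebraMap ℝ ℂ)).eval t = 0 → t.im = 0 := by
  set R := aeval (fun j => if j = i then (Polynomial.X : Polynomial ℝ) else Polynomial.C (x j)) q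
    with hR
  have hQ := IsUpperHalfPlaneStable.bind₁_ite_real_eq_zero_or hq x i
  set Q := bind₁ (fun j => if j = i then X i else C (x j : ℂ)) (map (algebraMap ℝ ℂ) q)
    with hQdef
  have key : ∀ t : ℂ, eval (fun _ => t) Q = (R.map (algebraMap ℝ ℂ)).eval t := fun t => by
    rw [hQdef, hR, eval_bind₁_ite, eval_map_aeval_ite]
  rcases hQ with h0 | hst
  · left
    rw [← Polynomial.map_eq_zero_iff (algebraMap ℝ ℂ).injective]
    refine Polynomial.funext fun t => ?_
    rw [Polynomial.eval_zero, ← key t, h0, map_zero]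
  · right
    intro t ht
    rcases lt_trichotomy t.im 0 with hlt | heq | hgt
    · exfalso
      refine hst (fun _ => conj t) (fun _ => ?_) ?_
      · show 0 < (conj t).im
        rw [Complex.conj_im]
        linarith
      · rw [key, ← conj_eval_map_algebraMap, ht, map_zero]
    · exact heq
    · exfalso
      exact hst (fun _ => t) (fun _ => hgt) (by rw [key, ht])

end Literature.Combinatorics.StablePolynomials

end
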